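import Literature.NumberTheory.BeurlingPrimes.HilberdinkDilation
import Mathlib.MeasureTheory.Integral.IntervalIntegral.Basic
import Mathlib.MeasureTheory.Function.LocallyIntegrable
import HarnessLib

/-!
# Hilberdink's uncertainty principle, VII: the jumps of `N_P` and the `L²` contradiction

Topic `Literature/NumberTheory/BeurlingPrimes`, grouping namespace `Hilberdink`. Everything in this
file is PROVED. It completes the `L²` replacement for Hilberdink 2005, §3 (proof of Theorem 1): there
the mean value `∫_{−T}^{T}|ζ_N(σ+it)|²dt` of a Dirichlet polynomial over the g-integers is bounded
BELOW by its diagonal `≫ T N^{1−2σ}` ("the * indicating that the multiplicities must be squared. In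
any case, we have `∑* ≥ ∑`") and ABOVE using `ζ(σ+it) = O(|t|^ε)`, which is "plainly absurd if
`Θ < 1/2`". Here the lower bound comes from the unit jumps of `N_P` directly:

* `Hilberdink.norm_sq_dilErr_ge` — on `[X, 3X]`, with `ρ = e^h`, `h = c₀/X`, `c₀ = min(1/(48a), 1/2)`:
  `‖G_ρ(x)‖² ≥ (N_P(ρx) − N_P(x))/16` (the count `N_P(ρx) − N_P(x) ∈ ℕ` of g-integers in `(x, ρx]`
  dominates the drift `aρ^{−σ₁}(ρ − 1)x ≤ 1/8` and the term `(1 − ρ^{−σ₁})|E(x)| ≤ 1/8`);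
* `Hilberdink.integral_count_ge` — `∫_X^{3X} (N_P(ρx) − N_P(x)) dx ≥ (ρ − 1)X (N_P(3X) − N_P(2X))`
  (substitution `u = ρx` and monotonicity of `N_P`), and `(ρ−1)X ≥ c₀`, `N_P(3X) − N_P(2X) ≥ aX/2`;
* `Hilberdink.integral_norm_sq_dilErr_ge` — hence `2π∫₀^∞ ‖G_ρ‖² x^{−2σ₁−1} dx ≥ c″ X^{−2σ₁}`;
* **`Hilberdink.false_of_mellin_bound`** — together with the upper bound `≤ 4K²I c₀^{2γ} X^{−2γ}`
  (file VI) for `σ₁ < γ`, `2γ + 2ε < 1`: a Beurling system cannot have `|N_P(x) − ax| ≤ Cx^θ`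
  (`0 ≤ θ < σ₁ < 1/2`) together with `‖∫₁^∞ E x^{−σ₁−1+it}dx‖ ≤ K(1+|t|)^{ε−1}` for an
  `ε < 1/2 − σ₁` — the form in which Theorem 1 is concluded in the Barriers proof file.

## References
* [Hilberdink2005] T. W. Hilberdink, *Well-behaved Beurling primes and integers*, J. Number Theory
  112 (2005) 332–344, §3, proof of Theorem 1 ((3.3)–(3.5)).
-/

noncomputable section

open Set Filter MeasureTheory Complex intervalIntegral
open scoped Topology Real

namespace Literature.NumberTheory.BeurlingPrimes

open Literature.Barriers.RiemannHypothesis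

namespace Hilberdink

variable {P : BeurlingPrimes} {a C θ σ₁ : ℝ}

/-! ### Elementary inequalities for `ρ = e^h`, `0 < h ≤ 1/2` -/

/-- `1 ≤ e^h ≤ 2`, `e^h − 1 ≥ h`, `e^h − 1 ≤ 2h`, `1 − e^{−σ₁h} ≤ σ₁h` bookkeeping. [folklore] -/
theorem exp_sub_one_le {h : ℝ} (hh : 0 < h) (hh1 : h ≤ 1 / 2) : Real.exp h - 1 ≤ 2 * h := by
  have h1 := Real.abs_exp_sub_one_sub_id_le (x := h) (by rw [abs_of_pos hh]; linarith)
  have := (abs_le.mp h1).2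
  nlinarith

/-- `e^h ≤ 2` for `0 < h ≤ 1/2`. [folklore] -/
theorem exp_le_two {h : ℝ} (hh : 0 < h) (hh1 : h ≤ 1 / 2) : Real.exp h ≤ 2 := by
  have := exp_sub_one_le hh hh1; linarith

/-- `1 − ρ^{−σ₁} ≤ σ₁ h` for `ρ = e^h`, `σ₁ ≥ 0`. [folklore] -/
theorem one_sub_rpow_le (h : ℝ) (σ₁ : ℝ) : 1 - Real.exp h ^ (-σ₁) ≤ σ₁ * h := by
  rw [← Real.exp_mul]
  have := Real.add_one_le_exp (h * -σ₁)
  nlinarith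

/-! ### The pointwise lower bound on `[X, 3X]` -/

/-- The constant `c₀ = min(1/(48a), 1/2)`. [folklore] -/
def c₀ (a : ℝ) : ℝ := min (1 / (48 * a)) (1 / 2)

/-- `0 < c₀ ≤ 1/2` and `48 a c₀ ≤ 1`. [folklore] -/
theorem c₀_pos (ha : 0 < a) : 0 < c₀ a := lt_min (by positivity) (by norm_num)

/-- The threshold `X₀ = 2 + 36C² + 100C²/a²`. [folklore] -/
def X₀ (a C : ℝ) : ℝ := 2 + 36 * C ^ 2 + 100 * C ^ 2 / a ^ 2

/-- For `X ≥ X₀`: `X ≥ 2`, `6C ≤ √X`, `10C/a ≤ √X`. [folklore] -/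
theorem X₀_le (ha : 0 < a) (hC : 0 ≤ C) {X : ℝ} (hX : X₀ a C ≤ X) :
    2 ≤ X ∧ 6 * C ≤ Real.sqrt X ∧ 10 * C / a ≤ Real.sqrt X := by
  unfold X₀ at hX
  have h1 : 0 ≤ 100 * C ^ 2 / a ^ 2 := by positivity
  have h2 : 0 ≤ 36 * C ^ 2 := by positivity
  refine ⟨by linarith, ?_, ?_⟩
  · rw [show 6 * C = Real.sqrt ((6 * C) ^ 2) by rw [Real.sqrt_sq (by positivity)]]
    exact Real.sqrt_le_sqrt (by nlinarith)
  · rw [show 10 * C / a = Real.sqrt ((10 * C / a) ^ 2) by rw [Real.sqrt_sq (by positivity)]]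
    refine Real.sqrt_le_sqrt ?_
    have : (10 * C / a) ^ 2 = 100 * C ^ 2 / a ^ 2 := by field_simp; ring
    linarith

/-- `C x^θ ≤ C √X · (x/X)`-type bound: for `1 ≤ X ≤ x ≤ 3X` and `0 ≤ θ ≤ 1/2`, `x^θ ≤ 3 √X`. [folklore] -/
theorem rpow_le_three_sqrt {X x : ℝ} (hX : 1 ≤ X) (hx : X ≤ x) (hx3 : x ≤ 3 * X) (hθ : θ ≤ 1 / 2) :
    x ^ θ ≤ 3 * Real.sqrt X := by
  have hx1 : 1 ≤ x := hX.trans hx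
  calc x ^ θ ≤ x ^ (1 / 2 : ℝ) := Real.rpow_le_rpow_of_exponent_le hx1 hθ
    _ ≤ (3 * X) ^ (1 / 2 : ℝ) := Real.rpow_le_rpow (by linarith) hx3 (by norm_num)
    _ = Real.sqrt 3 * Real.sqrt X := by
        rw [← Real.sqrt_eq_rpow, Real.sqrt_mul (by norm_num)]
    _ ≤ 3 * Real.sqrt X := by
        refine mul_le_mul_of_nonneg_right ?_ (Real.sqrt_nonneg X)
        rw [show (3 : ℝ) = Real.sqrt (3 ^ 2) by rw [Real.sqrt_sq (by norm_num)]]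
        exact Real.sqrt_le_sqrt (by norm_num)

/-- **The pointwise bound.** For `X ≥ X₀`, `h = c₀/X`, `ρ = e^h` and `x ∈ [X, 3X]`:
`(N_P(ρx) − N_P(x))/16 ≤ ‖G_ρ(x)‖²` (`0 ≤ θ ≤ 1/2`, `θ ≤ σ₁ ≤ 1/2`). [cite: Hilberdink2005, §3] -/
theorem norm_sq_dilErr_ge (ha : 0 < a) (hN : ∀ x : ℝ, 1 ≤ x → |(P.intCount x : ℝ) - a * x| ≤ C * x ^ θ)
    (hθ : θ ≤ 1 / 2) (hσ0 : 0 ≤ σ₁) (hσ : σ₁ ≤ 1 / 2) {X : ℝ} (hX : X₀ a C ≤ X)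
    {x : ℝ} (hx : x ∈ Icc X (3 * X)) :
    ((P.intCount (Real.exp (c₀ a / X) * x) : ℝ) - P.intCount x) / 16 ≤
      ‖dilErr P a σ₁ (Real.exp (c₀ a / X)) x‖ ^ 2 := by
  have hC := const_nonneg hN
  obtain ⟨hX2, hX6, hX10⟩ := X₀_le ha hC hX
  have hX1 : 1 ≤ X := by linarith
  have hX0 : 0 < X := by linarith
  set h : ℝ := c₀ a / X with hhdef
  have hc₀ := c₀_pos ha
  have hc₀le : c₀ a ≤ 1 / 2 := min_le_right _ _
  have hc₀a : c₀ a ≤ 1 / (48 * a) := min_le_left _ _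
  have hh0 : 0 < h := div_pos hc₀ hX0
  have hh1 : h ≤ 1 / 2 := by
    rw [hhdef, div_le_iff₀ hX0]; nlinarith
  set ρ : ℝ := Real.exp h with hρdef
  have hρ1 : 1 ≤ ρ := Real.one_le_exp hh0.le
  have hρ2 : ρ ≤ 2 := exp_le_two hh0 hh1
  have hρ0 : 0 < ρ := by linarith
  set u : ℝ := ρ ^ (-σ₁) with hudef
  have hu1 : u ≤ 1 := Real.rpow_le_one_of_one_le_of_nonpos hρ1 (by linarith)
  have hu0 : 0 < u := Real.rpow_pos_of_pos hρ0 _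
  have hu2 : 1 / 2 ≤ u := by
    have := one_sub_rpow_le h σ₁; rw [← hρdef, ← hudef] at this; nlinarith
  -- the points `x`, `ρx` are `> 1`
  have hxX : X ≤ x := hx.1
  have hx3 : x ≤ 3 * X := hx.2
  have hx1 : 1 < x := by linarith
  have hρx1 : 1 < ρ * x := by nlinarith
  -- the decomposition `G_ρ(x) = u D + (u − 1) E − u a (ρ − 1) x`
  set D : ℝ := (P.intCount (ρ * x) : ℝ) - P.intCount x with hDdef
  set E : ℝ := (P.intCount x : ℝ) - a * x with hEdef
  have hval : dilErr P a σ₁ ρ x = ((u * D + (u - 1) * E - u * (a * (ρ - 1) * x) : ℝ) : ℂ) := by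
    simp only [dilErr, errN_of_one_lt hx1, errN_of_one_lt hρx1, hDdef, hEdef, hudef]
    push_cast
    ring
  rw [hval, Complex.norm_real, Real.norm_eq_abs, sq_abs]
  clear_value u ρ h D E
  -- sizes of the two small terms
  have hE : |E| ≤ C * x ^ θ := by rw [hEdef]; exact hN x hx1.le
  have hxθ : x ^ θ ≤ 3 * Real.sqrt X := rpow_le_three_sqrt hX1 hxX hx3 hθ
  have hsmall1 : |(u - 1) * E| ≤ 1 / 8 := by
    rw [abs_mul]
    have h1u : |u - 1| ≤ h / 2 := by
      rw [abs_sub_comm, abs_of_nonneg (by linarith)]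
      have := one_sub_rpow_le h σ₁
      rw [← hρdef, ← hudef] at this
      nlinarith
    have hsq : Real.sqrt X * Real.sqrt X = X := Real.mul_self_sqrt hX0.le
    calc |u - 1| * |E| ≤ (h / 2) * (C * (3 * Real.sqrt X)) :=
          mul_le_mul h1u (hE.trans (mul_le_mul_of_nonneg_left hxθ hC)) (abs_nonneg _) (by linarith)
      _ = (c₀ a * 3 / 2) * (C * Real.sqrt X) / X := by rw [hhdef]; ring
      _ ≤ (c₀ a * 3 / 2) * (Real.sqrt X * Real.sqrt X / 6) / X := by
          gcongr
          nlinarith [Real.sqrt_nonneg X]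
      _ = c₀ a / 4 := by rw [hsq]; field_simp; ring
      _ ≤ 1 / 8 := by linarith
  have hsmall2 : 0 ≤ u * (a * (ρ - 1) * x) ∧ u * (a * (ρ - 1) * x) ≤ 1 / 8 := by
    have hρ1' : ρ - 1 ≤ 2 * h := by rw [hρdef]; exact exp_sub_one_le hh0 hh1
    refine ⟨by positivity, ?_⟩
    have hin : a * (ρ - 1) * x ≤ a * (2 * h) * (3 * X) :=
      mul_le_mul (mul_le_mul_of_nonneg_left hρ1' ha.le) hx3 (by linarith) (by positivity)
    calc u * (a * (ρ - 1) * x) ≤ 1 * (a * (2 * h) * (3 * X)) :=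
          mul_le_mul hu1 hin (by positivity) zero_le_one
      _ = 6 * a * c₀ a := by rw [hhdef]; field_simp; norm_num
      _ ≤ 6 * a * (1 / (48 * a)) := by gcongr
      _ = 1 / 8 := by field_simp; ring
  -- `D` is a natural number
  have hmono : P.intCount x ≤ P.intCount (ρ * x) := P.intCount_mono (by nlinarith)
  obtain ⟨m, hm⟩ : ∃ m : ℕ, D = m := ⟨P.intCount (ρ * x) - P.intCount x, by
    rw [hDdef, Nat.cast_sub hmono]⟩
  rcases Nat.eq_zero_or_pos m with hm0 | hm1
  · rw [hm, hm0]; simp only [Nat.cast_zero, zero_div]; positivity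
  · have hD1 : 1 ≤ D := by rw [hm]; exact_mod_cast hm1
    have habs := abs_le.mp hsmall1
    have huD : 0 ≤ (u - 1 / 2) * D := mul_nonneg (by linarith) (by linarith)
    have huD' : D / 2 ≤ u * D := by
      rw [show u * D = (u - 1 / 2) * D + D / 2 by ring]; linarith
    have hlow : D / 4 ≤ u * D + (u - 1) * E - u * (a * (ρ - 1) * x) := by linarith [habs.1, hsmall2.2]
    have hDpos : 0 ≤ D / 4 := by linarith
    have hDD : D ≤ D * D := le_mul_of_one_le_left (by linarith) hD1
    calc D / 16 ≤ D * D / 16 := div_le_div_of_nonneg_right hDD (by norm_num)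
      _ = (D / 4) ^ 2 := by ring
      _ ≤ (u * D + (u - 1) * E - u * (a * (ρ - 1) * x)) ^ 2 := pow_le_pow_left₀ hDpos hlow 2

/-! ### The integral of the count `N_P(ρx) − N_P(x)` -/

/-- `u ↦ N_P(u)` (real-valued) is integrable on compact intervals. [folklore] -/
theorem intervalIntegrable_intCount (P : BeurlingPrimes) (c : ℝ) (hc : 0 ≤ c) (α β : ℝ) :
    IntervalIntegrable (fun u : ℝ ↦ (P.intCount (c * u) : ℝ)) volume α β :=
  ((monotone_intCount_real P).comp (fun _ _ h ↦ mul_le_mul_of_nonneg_left h hc)).intervalIntegrable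

/-- **`∫_X^{3X} (N_P(ρx) − N_P(x)) dx ≥ (ρ − 1) X (N_P(3X) − N_P(2X))`** for `1 ≤ ρ ≤ 2`, `X ≥ 0`
(substitute `u = ρx` and use monotonicity of `N_P`). [cite: Hilberdink2005, §3] -/
theorem integral_count_ge (P : BeurlingPrimes) {ρ X : ℝ} (hρ1 : 1 ≤ ρ) (hρ2 : ρ ≤ 2) (hX : 0 ≤ X) :
    (ρ - 1) * X * ((P.intCount (3 * X) : ℝ) - P.intCount (2 * X)) ≤
      ∫ x in X..3 * X, ((P.intCount (ρ * x) : ℝ) - P.intCount x) := by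
  set Nf : ℝ → ℝ := fun u ↦ (P.intCount u : ℝ) with hNf
  have hmono : Monotone Nf := monotone_intCount_real P
  have hρ0 : 0 < ρ := by linarith
  have hii : ∀ α β : ℝ, IntervalIntegrable Nf volume α β := fun α β ↦ hmono.intervalIntegrable
  have hiiρ : ∀ α β : ℝ, IntervalIntegrable (fun u ↦ Nf (ρ * u)) volume α β := fun α β ↦
    (hmono.comp (fun _ _ h ↦ mul_le_mul_of_nonneg_left h hρ0.le)).intervalIntegrable
  -- substitution
  have hsub : ∫ x in X..3 * X, Nf (ρ * x) = ρ⁻¹ * ∫ u in ρ * X..ρ * (3 * X), Nf u := by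
    rw [intervalIntegral.integral_comp_mul_left Nf hρ0.ne', smul_eq_mul]
  -- splitting
  set I₁ := ∫ u in ρ * X..3 * X, Nf u with hI₁
  set I₂ := ∫ u in (3 * X)..ρ * (3 * X), Nf u with hI₂
  set I₃ := ∫ u in X..ρ * X, Nf u with hI₃
  have hsplit1 : ∫ u in ρ * X..ρ * (3 * X), Nf u = I₁ + I₂ :=
    (intervalIntegral.integral_add_adjacent_intervals (hii _ _) (hii _ _)).symm
  have hsplit2 : ∫ u in X..3 * X, Nf u = I₃ + I₁ :=
    (intervalIntegral.integral_add_adjacent_intervals (hii _ _) (hii _ _)).symm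
  -- monotone bounds
  have hle1 : ρ * X ≤ 3 * X := by nlinarith
  have hle2 : 3 * X ≤ ρ * (3 * X) := by nlinarith
  have hle3 : X ≤ ρ * X := by nlinarith
  have hb1 : I₁ ≤ (3 * X - ρ * X) * Nf (3 * X) := by
    have := intervalIntegral.integral_mono_on hle1 (hii _ _) intervalIntegrable_const
      (fun u hu ↦ hmono hu.2 : ∀ u ∈ Icc (ρ * X) (3 * X), Nf u ≤ Nf (3 * X))
    rwa [intervalIntegral.integral_const, smul_eq_mul] at this
  have hb2 : (ρ * (3 * X) - 3 * X) * Nf (3 * X) ≤ I₂ := by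
    have := intervalIntegral.integral_mono_on hle2 intervalIntegrable_const (hii _ _)
      (fun u hu ↦ hmono hu.1 : ∀ u ∈ Icc (3 * X) (ρ * (3 * X)), Nf (3 * X) ≤ Nf u)
    rwa [intervalIntegral.integral_const, smul_eq_mul] at this
  have hb3 : I₃ ≤ (ρ * X - X) * Nf (ρ * X) := by
    have := intervalIntegral.integral_mono_on hle3 (hii _ _) intervalIntegrable_const
      (fun u hu ↦ hmono hu.2 : ∀ u ∈ Icc X (ρ * X), Nf u ≤ Nf (ρ * X))
    rwa [intervalIntegral.integral_const, smul_eq_mul] at this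
  have hNρ : Nf (ρ * X) ≤ Nf (2 * X) := hmono (by nlinarith)
  have hN30 : 0 ≤ Nf (3 * X) := Nat.cast_nonneg _
  -- assemble
  have htot : ∫ x in X..3 * X, (Nf (ρ * x) - Nf x) = ρ⁻¹ * (I₁ + I₂) - (I₃ + I₁) := by
    rw [intervalIntegral.integral_sub (hiiρ _ _) (hii _ _), hsub, hsplit1, hsplit2]
  show (ρ - 1) * X * (Nf (3 * X) - Nf (2 * X)) ≤ ∫ x in X..3 * X, (Nf (ρ * x) - Nf x)
  rw [htot]
  have key : ρ * (ρ⁻¹ * (I₁ + I₂) - (I₃ + I₁)) - ρ * (ρ - 1) * X * (Nf (3 * X) - Nf (ρ * X)) =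
      (I₂ - (ρ * (3 * X) - 3 * X) * Nf (3 * X)) + (ρ - 1) * ((3 * X - ρ * X) * Nf (3 * X) - I₁) +
        ρ * ((ρ * X - X) * Nf (ρ * X) - I₃) := by
    field_simp
    ring
  have hnonneg : 0 ≤ ρ * (ρ⁻¹ * (I₁ + I₂) - (I₃ + I₁)) - ρ * (ρ - 1) * X * (Nf (3 * X) - Nf (ρ * X)) := by
    rw [key]
    have t1 : 0 ≤ I₂ - (ρ * (3 * X) - 3 * X) * Nf (3 * X) := by linarith
    have t2 : 0 ≤ (ρ - 1) * ((3 * X - ρ * X) * Nf (3 * X) - I₁) := mul_nonneg (by linarith) (by linarith)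
    have t3 : 0 ≤ ρ * ((ρ * X - X) * Nf (ρ * X) - I₃) := mul_nonneg hρ0.le (by linarith)
    linarith
  -- divide by `ρ > 0`
  have h1 : (ρ - 1) * X * (Nf (3 * X) - Nf (ρ * X)) ≤ ρ⁻¹ * (I₁ + I₂) - (I₃ + I₁) := by
    have := div_nonneg hnonneg hρ0.le
    have e : (ρ * (ρ⁻¹ * (I₁ + I₂) - (I₃ + I₁)) - ρ * (ρ - 1) * X * (Nf (3 * X) - Nf (ρ * X))) / ρ =
        (ρ⁻¹ * (I₁ + I₂) - (I₃ + I₁)) - (ρ - 1) * X * (Nf (3 * X) - Nf (ρ * X)) := by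
      field_simp
    rw [e] at this
    linarith
  have h2 : (ρ - 1) * X * (Nf (3 * X) - Nf (2 * X)) ≤ (ρ - 1) * X * (Nf (3 * X) - Nf (ρ * X)) :=
    mul_le_mul_of_nonneg_left (by linarith) (mul_nonneg (by linarith) hX)
  exact h2.trans h1

/-- `N_P(3X) − N_P(2X) ≥ aX/4` for `X ≥ X₀` (`0 ≤ θ ≤ 1/2`). [folklore] -/
theorem count_ge (ha : 0 < a) (hN : ∀ x : ℝ, 1 ≤ x → |(P.intCount x : ℝ) - a * x| ≤ C * x ^ θ)
    (hθ : θ ≤ 1 / 2) {X : ℝ} (hX : X₀ a C ≤ X) :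
    a * X / 4 ≤ (P.intCount (3 * X) : ℝ) - P.intCount (2 * X) := by
  have hC := const_nonneg hN
  obtain ⟨hX2, -, hX10⟩ := X₀_le ha hC hX
  have hX1 : 1 ≤ X := by linarith
  have h3 := (abs_le.mp (hN (3 * X) (by linarith))).1
  have h2 := (abs_le.mp (hN (2 * X) (by linarith))).2
  have hθ3 : (3 * X) ^ θ ≤ 3 * Real.sqrt X := rpow_le_three_sqrt hX1 (by linarith) le_rfl hθ
  have hθ2 : (2 * X) ^ θ ≤ 3 * Real.sqrt X := rpow_le_three_sqrt hX1 (by linarith) (by linarith) hθ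
  have hsq : Real.sqrt X * Real.sqrt X = X := Real.mul_self_sqrt (by linarith)
  -- `6 C √X ≤ (a/2) · ... `: from `10C/a ≤ √X` we get `C √X ≤ a X/10`
  have h10 : 10 * C ≤ Real.sqrt X * a := (div_le_iff₀ ha).mp hX10
  have hCX : C * Real.sqrt X ≤ a * X / 10 := by nlinarith [Real.sqrt_nonneg X, hsq]
  linarith [mul_le_mul_of_nonneg_left hθ3 hC, mul_le_mul_of_nonneg_left hθ2 hC]

/-! ### The `L²` lower bound and the contradiction -/

/-- **The lower bound**: for `X ≥ X₀`, `h = c₀/X`, `ρ = e^h`,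
`(3X)^{−2σ₁−1} a c₀ X / 64 ≤ ∫₀^∞ ‖G_ρ(x)‖² x^{−2σ₁−1} dx` (`0 ≤ θ < σ₁ ≤ 1/2`).
[cite: Hilberdink2005, §3] -/
theorem integral_norm_sq_dilErr_ge (ha : 0 < a)
    (hN : ∀ x : ℝ, 1 ≤ x → |(P.intCount x : ℝ) - a * x| ≤ C * x ^ θ)
    (hθ0 : 0 ≤ θ) (hθσ : θ < σ₁) (hσ : σ₁ ≤ 1 / 2) {X : ℝ} (hX : X₀ a C ≤ X) :
    (3 * X) ^ (2 * (-σ₁) - 1) * (a * c₀ a * X / 64) ≤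
      ∫ x in Ioi (0 : ℝ), ‖dilErr P a σ₁ (Real.exp (c₀ a / X)) x‖ ^ 2 * x ^ (2 * (-σ₁) - 1) := by
  have hC := const_nonneg hN
  obtain ⟨hX2, -, -⟩ := X₀_le ha hC hX
  have hX0 : 0 < X := by linarith
  have hθ : θ ≤ 1 / 2 := by linarith
  have hσ0 : 0 ≤ σ₁ := by linarith
  set h : ℝ := c₀ a / X with hhdef
  have hc₀ := c₀_pos ha
  have hc₀le : c₀ a ≤ 1 / 2 := min_le_right _ _
  have hh0 : 0 < h := div_pos hc₀ hX0
  have hh1 : h ≤ 1 / 2 := by rw [hhdef, div_le_iff₀ hX0]; nlinarith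
  set ρ : ℝ := Real.exp h with hρdef
  have hρ1 : 1 ≤ ρ := Real.one_le_exp hh0.le
  have hρ2 : ρ ≤ 2 := exp_le_two hh0 hh1
  set f : ℝ → ℝ := fun x ↦ ‖dilErr P a σ₁ ρ x‖ ^ 2 * x ^ (2 * (-σ₁) - 1) with hf
  have hfi : IntegrableOn f (Ioi 0) := integrableOn_norm_sq_dilErr hN hθ0 (by linarith) hθσ hρ1 hρ2
  have hf0 : 0 ≤ᵐ[volume.restrict (Ioi 0)] f := by
    rw [EventuallyLE, ae_restrict_iff' measurableSet_Ioi]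
    exact Eventually.of_forall fun x hx ↦ mul_nonneg (sq_nonneg _) (Real.rpow_nonneg (le_of_lt hx) _)
  -- restrict to `[X, 3X]`
  have hsub : Icc X (3 * X) ⊆ Ioi 0 := fun x hx ↦ lt_of_lt_of_le hX0 hx.1
  have hstep1 : ∫ x in Icc X (3 * X), f x ≤ ∫ x in Ioi 0, f x :=
    setIntegral_mono_set hfi hf0 (Eventually.of_forall hsub)
  -- on `[X, 3X]`: `f x ≥ (3X)^{−2σ₁−1} · D(x)/16`
  set w : ℝ := (3 * X) ^ (2 * (-σ₁) - 1) with hw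
  have hw0 : 0 < w := Real.rpow_pos_of_pos (by linarith) _
  set Dg : ℝ → ℝ := fun x ↦ (P.intCount (ρ * x) : ℝ) - P.intCount x with hDg
  have hDi : IntegrableOn Dg (Icc X (3 * X)) := by
    have h1 : IntegrableOn (fun x : ℝ ↦ (P.intCount (ρ * x) : ℝ)) (Icc X (3 * X)) :=
      (((monotone_intCount_real P).comp (fun _ _ h ↦ mul_le_mul_of_nonneg_left h (by linarith))).monotoneOn
        _).integrableOn_isCompact isCompact_Icc
    have h2 : IntegrableOn (fun x : ℝ ↦ (P.intCount x : ℝ)) (Icc X (3 * X)) :=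
      ((monotone_intCount_real P).monotoneOn _).integrableOn_isCompact isCompact_Icc
    exact h1.sub h2
  have hpt : ∀ x ∈ Icc X (3 * X), w / 16 * Dg x ≤ f x := by
    intro x hx
    have hx0 : 0 < x := lt_of_lt_of_le hX0 hx.1
    have hD := norm_sq_dilErr_ge (P := P) (σ₁ := σ₁) ha hN hθ hσ0 hσ hX hx
    have hxw : w ≤ x ^ (2 * (-σ₁) - 1) := by
      rw [hw]; exact Real.rpow_le_rpow_of_nonpos hx0 hx.2 (by linarith)
    have hD0 : 0 ≤ Dg x := sub_nonneg.mpr (Nat.cast_le.mpr (P.intCount_mono (by nlinarith [hx.1])))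
    calc w / 16 * Dg x = (Dg x / 16) * w := by ring
      _ ≤ ‖dilErr P a σ₁ ρ x‖ ^ 2 * x ^ (2 * (-σ₁) - 1) :=
          mul_le_mul hD hxw hw0.le (sq_nonneg _)
  have hstep2 : ∫ x in Icc X (3 * X), w / 16 * Dg x ≤ ∫ x in Icc X (3 * X), f x :=
    setIntegral_mono_on (hDi.const_mul _) (hfi.mono_set hsub) measurableSet_Icc hpt
  -- the count integral
  have hstep3 : (ρ - 1) * X * ((P.intCount (3 * X) : ℝ) - P.intCount (2 * X)) ≤ ∫ x in Icc X (3 * X), Dg x := by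
    have := integral_count_ge P hρ1 hρ2 hX0.le
    rwa [intervalIntegral.integral_of_le (by linarith), ← integral_Icc_eq_integral_Ioc] at this
  have hρh : h ≤ ρ - 1 := by have := Real.add_one_le_exp h; rw [hρdef]; linarith
  have hcount := count_ge ha hN hθ hX
  have hkey : a * c₀ a * X / 4 ≤ ∫ x in Icc X (3 * X), Dg x := by
    have h1 : c₀ a ≤ (ρ - 1) * X := by
      calc c₀ a = h * X := by rw [hhdef]; field_simp
        _ ≤ (ρ - 1) * X := mul_le_mul_of_nonneg_right hρh hX0.le
    have h2 : c₀ a * (a * X / 4) ≤ (ρ - 1) * X * ((P.intCount (3 * X) : ℝ) - P.intCount (2 * X)) :=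
      mul_le_mul h1 hcount (by positivity) (by nlinarith)
    linarith
  calc w * (a * c₀ a * X / 64) = w / 16 * (a * c₀ a * X / 4) := by ring
    _ ≤ w / 16 * ∫ x in Icc X (3 * X), Dg x := mul_le_mul_of_nonneg_left hkey (by positivity)
    _ = ∫ x in Icc X (3 * X), w / 16 * Dg x := (MeasureTheory.integral_const_mul _ _).symm
    _ ≤ ∫ x in Icc X (3 * X), f x := hstep2
    _ ≤ ∫ x in Ioi 0, f x := hstep1

/-- **Hilberdink 2005, Theorem 1 — the analytic core in `L²` form.** There is no Beurling system with
`|N_P(x) − ax| ≤ Cx^θ` on `[1,∞)` (`a > 0`, `0 ≤ θ < σ₁ < 1/2`) whose error Mellin transform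
satisfies `‖∫₁^∞ E(x) x^{−σ₁−1+it} dx‖ ≤ K (1+|t|)^{ε−1}` for all real `t` with some `0 < ε`,
`σ₁ + ε < 1/2`: the lower bound `≫ X^{−2σ₁}` and the upper bound `≪ X^{−2γ}` (`σ₁ < γ`,
`2γ + 2ε < 1`) for `2π∫₀^∞‖G_ρ‖²x^{−2σ₁−1}` are incompatible as `X → ∞` ("This is plainly absurd
if `Θ < 1/2`"). [cite: Hilberdink2005, Theorem 1 (proof, §3)] -/
theorem false_of_mellin_bound (ha : 0 < a)
    (hN : ∀ x : ℝ, 1 ≤ x → |(P.intCount x : ℝ) - a * x| ≤ C * x ^ θ)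
    (hθ0 : 0 ≤ θ) (hθσ : θ < σ₁) {ε K : ℝ} (hε : 0 < ε) (hσε : σ₁ + ε < 1 / 2)
    (hK : ∀ t : ℝ, ‖mellin (errN P a) (-σ₁ + t * I)‖ ≤ K * (1 + |t|) ^ (ε - 1)) : False := by
  have hC := const_nonneg hN
  -- the exponent `γ` strictly between `σ₁` and `1/2 − ε`
  set γ : ℝ := (σ₁ + (1 / 2 - ε)) / 2 with hγdef
  have hσγ : σ₁ < γ := by rw [hγdef]; linarith
  have hγε : 2 * γ + 2 * ε < 1 := by rw [hγdef]; linarith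
  have hγ0 : 0 ≤ γ := by linarith
  have hγ1 : γ ≤ 1 := by linarith
  have hσ : σ₁ ≤ 1 / 2 := by linarith
  set Iint : ℝ := ∫ τ : ℝ, (1 + |τ|) ^ (-(2 - 2 * γ - 2 * ε)) with hIdef
  have hc₀ := c₀_pos ha
  have hc₀le : c₀ a ≤ 1 / 2 := min_le_right _ _
  -- for every `X ≥ X₀`: lower ≤ upper
  have hboth : ∀ X : ℝ, X₀ a C ≤ X →
      (3 * X) ^ (2 * (-σ₁) - 1) * (a * c₀ a * X / 64) ≤
        (4 * K ^ 2 * Iint * (c₀ a) ^ (2 * γ)) / (2 * π) * X ^ (-(2 * γ)) := by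
    intro X hX
    obtain ⟨hX2, -, -⟩ := X₀_le ha hC hX
    have hX0 : 0 < X := by linarith
    have hh0 : 0 < c₀ a / X := div_pos hc₀ hX0
    have hh1 : c₀ a / X ≤ 1 / 2 := by rw [div_le_iff₀ hX0]; nlinarith
    have hlow := integral_norm_sq_dilErr_ge (P := P) (σ₁ := σ₁) ha hN hθ0 hθσ hσ hX
    have hup := integral_norm_sq_dilErr_le (P := P) (σ₁ := σ₁) hN hθ0 (by linarith) hθσ hε hγ0 hγ1 hγε
      hh0 hh1 hK
    have hπ : 0 < 2 * π := by positivity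
    have hup' : ∫ x in Ioi (0 : ℝ), ‖dilErr P a σ₁ (Real.exp (c₀ a / X)) x‖ ^ 2 * x ^ (2 * (-σ₁) - 1) ≤
        (4 * K ^ 2 * Iint * (c₀ a / X) ^ (2 * γ)) / (2 * π) := by
      rw [le_div_iff₀ hπ, mul_comm]; exact hup
    have hsplit : (c₀ a / X) ^ (2 * γ) = (c₀ a) ^ (2 * γ) * X ^ (-(2 * γ)) := by
      rw [Real.div_rpow hc₀.le hX0.le, Real.rpow_neg hX0.le, div_eq_mul_inv]
    calc (3 * X) ^ (2 * (-σ₁) - 1) * (a * c₀ a * X / 64) ≤ _ := hlow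
      _ ≤ (4 * K ^ 2 * Iint * (c₀ a / X) ^ (2 * γ)) / (2 * π) := hup'
      _ = (4 * K ^ 2 * Iint * (c₀ a) ^ (2 * γ)) / (2 * π) * X ^ (-(2 * γ)) := by rw [hsplit]; ring
  -- rewrite the lower bound as `c″ X^{−2σ₁}` and compare exponents
  set cL : ℝ := 3 ^ (2 * (-σ₁) - 1) * (a * c₀ a / 64) with hcL
  have hcL0 : 0 < cL := by rw [hcL]; positivity
  set cU : ℝ := (4 * K ^ 2 * Iint * (c₀ a) ^ (2 * γ)) / (2 * π) with hcU
  have hexp : ∀ X : ℝ, X₀ a C ≤ X → cL * X ^ (2 * γ - 2 * σ₁) ≤ cU := by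
    intro X hX
    obtain ⟨hX2, -, -⟩ := X₀_le ha hC hX
    have hX0 : 0 < X := by linarith
    have h := hboth X hX
    have e1 : (3 * X) ^ (2 * (-σ₁) - 1) * (a * c₀ a * X / 64) = cL * X ^ (2 * (-σ₁)) := by
      rw [hcL, Real.mul_rpow (by norm_num) hX0.le]
      have : X ^ (2 * (-σ₁) - 1) * X = X ^ (2 * (-σ₁)) := by
        calc X ^ (2 * (-σ₁) - 1) * X = X ^ (2 * (-σ₁) - 1) * X ^ (1 : ℝ) := by rw [Real.rpow_one]
          _ = X ^ (2 * (-σ₁) - 1 + 1) := (Real.rpow_add hX0 _ _).symm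
          _ = X ^ (2 * (-σ₁)) := by norm_num
      calc 3 ^ (2 * (-σ₁) - 1) * X ^ (2 * (-σ₁) - 1) * (a * c₀ a * X / 64)
          = 3 ^ (2 * (-σ₁) - 1) * (a * c₀ a / 64) * (X ^ (2 * (-σ₁) - 1) * X) := by ring
        _ = _ := by rw [this]
    rw [e1] at h
    -- multiply by `X^{2γ} > 0`
    have hXγ : 0 < X ^ (2 * γ) := Real.rpow_pos_of_pos hX0 _
    have e2 : X ^ (2 * (-σ₁)) * X ^ (2 * γ) = X ^ (2 * γ - 2 * σ₁) := by
      rw [← Real.rpow_add hX0]; ring_nf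
    have e3 : X ^ (-(2 * γ)) * X ^ (2 * γ) = 1 := by
      rw [← Real.rpow_add hX0]; simp
    have := mul_le_mul_of_nonneg_right h hXγ.le
    calc cL * X ^ (2 * γ - 2 * σ₁) = cL * (X ^ (2 * (-σ₁)) * X ^ (2 * γ)) := by rw [e2]
      _ = cL * X ^ (2 * (-σ₁)) * X ^ (2 * γ) := (mul_assoc _ _ _).symm
      _ ≤ cU * X ^ (-(2 * γ)) * X ^ (2 * γ) := this
      _ = cU * (X ^ (-(2 * γ)) * X ^ (2 * γ)) := mul_assoc _ _ _
      _ = cU := by rw [e3, mul_one]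
  -- choose `X` large
  have hpow : 0 < 2 * γ - 2 * σ₁ := by linarith
  set X : ℝ := max (X₀ a C) ((cU / cL + 1) ^ (1 / (2 * γ - 2 * σ₁))) with hXdef
  have hX : X₀ a C ≤ X := le_max_left _ _
  obtain ⟨hX2, -, -⟩ := X₀_le ha hC hX
  have hcUL : 0 ≤ cU / cL + 1 := by
    have : 0 ≤ cU := le_trans (by positivity) (hexp X hX)
    positivity
  have hXge : (cU / cL + 1) ^ (1 / (2 * γ - 2 * σ₁)) ≤ X := le_max_right _ _
  have h1 : cU / cL + 1 ≤ X ^ (2 * γ - 2 * σ₁) := by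
    calc cU / cL + 1 = ((cU / cL + 1) ^ (1 / (2 * γ - 2 * σ₁))) ^ (2 * γ - 2 * σ₁) := by
          rw [← Real.rpow_mul hcUL, one_div_mul_cancel hpow.ne', Real.rpow_one]
      _ ≤ X ^ (2 * γ - 2 * σ₁) :=
          Real.rpow_le_rpow (Real.rpow_nonneg hcUL _) hXge hpow.le
  have h2 := hexp X hX
  have h3 : cL * (cU / cL + 1) ≤ cU := le_trans (mul_le_mul_of_nonneg_left h1 hcL0.le) h2
  have h4 : cL * (cU / cL + 1) = cU + cL := by field_simp
  linarith

end Hilberdink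

end Literature.NumberTheory.BeurlingPrimes
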